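import Literature.NumberTheory.EllipticCurves.Kato2004.H1CoefficientChange
import HarnessLib

/-!
# The coefficient change `u_* : H¹(V, T_pA) → H¹(V, T_pW)` (`Kato2004.twistH1On`): cocycle formula, integrality,
# compatibility with corestriction and with the Galois action — THEOREMS ONLY

Topic `NumberTheory/EllipticCurves`, sub-directory `Kato2004` (namespace = path). Cell `bsd-2adic`, seat `bsd-2adic-addL2x`
GEN 21 (crux stmt-BirchSwinnertonDyer-19098, child C4″ stmt-BirchSwinnertonDyer-22618; reading step T22 (b), odd-branch side).
Companion of `H1CoefficientChange.lean` (the definitions `twistRepHomOn`, `twistH1On`); the proofs are those of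
`IwasawaCohomologyNumberFieldTwistModel` (`layerTwist_*`, seat `bsd-2adic-conv-1` GEN 30) for an ARBITRARY subgroup `V` on which
`u` is equivariant. No definition, no named fact, no instance; nothing about any curve is asserted; BSD is not advanced.

* `twistH1On_oneCocycleClass` — on cocycles `[φ] ↦ [u ∘ φ]`;
* `twistH1On_smul`, `twistH1On_add` — `ℤ_p`-linearity;
* `twistH1On_mem_integralH1` — integral classes go to integral classes;
* `twistH1On_coresLe` — `u_*` commutes with the corestriction `cor_{V′/V}` for `V′ ≤ V`;
* `twistH1On_conjMap` / `twistH1On_conjMap_of_neg` — `u_* (g · c) = ± g · u_* c` according to `u (g • x) = ± g • u x`.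

References: J.-P. Serre, *Galois Cohomology* (1997), I §2.4 [SerreGaloisCohomology1997]; J. Neukirch, A. Schmidt, K. Wingberg,
*Cohomology of Number Fields* (2008), I §5 Prop. 1.5.4 [NeukirchSchmidtWingberg2008]; K. Kato, Astérisque 295 (2004) §8.2
[Kato2004Asterisque]; J. H. Silverman, *AEC* (2009) X.5 Cor. 5.4 [SilvermanAEC2009].
-/

noncomputable section

open scoped NumberField Pointwise
open CategoryTheory Field IsDedekindDomain
open Literature.NumberTheory.GaloisRepresentations
open Literature.NumberTheory.EllipticCurves (subgroupInclusion subgroupInclusion_apply_coe)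
open Literature.NumberTheory.EllipticCurves.Kato2004.EulerSystemValues (tateRep)

namespace Literature.NumberTheory.EllipticCurves.Kato2004

section CoefficientChange

variable {p : ℕ} [Fact p.Prime]
  (W : WeierstrassCurve ℚ) [W.IsElliptic] [ContinuousSMul ℤ_[p] (W.tateModule p)]
  (A' : WeierstrassCurve ℚ) [A'.IsElliptic] [ContinuousSMul ℤ_[p] (A'.tateModule p)]
  (u : A'.tateModule p ≃ₗ[ℤ_[p]] W.tateModule p) (hu : Continuous u)
  {V : Subgroup (absoluteGaloisGroup ℚ)}
  (hV : ∀ σ : absoluteGaloisGroup ℚ, σ ∈ V → ∀ x : A'.tateModule p, u (σ • x) = σ • u x)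

/-- The action of `tateRep` is the Galois action on `T_p` (unfolding). [folklore] -/
private theorem tateRep_ρ_apply' (Z : WeierstrassCurve ℚ) [Z.IsElliptic] [ContinuousSMul ℤ_[p] (Z.tateModule p)]
    (σ : absoluteGaloisGroup ℚ) (x : Z.tateModule p) : (tateRep Z p).toTopRep.ρ σ x = σ • x := rfl

/-- `u_*` on explicit cocycles: `[φ] ↦ [u ∘ φ]`. [cite: SerreGaloisCohomology1997, I §2.4] -/
theorem twistH1On_oneCocycleClass (φ : contOneCocycles (subgroupRep (tateRep A' p).toTopRep V)) :
    twistH1On W A' u hu hV (oneCocycleClass _ φ) =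
      oneCocycleClass _ (contOneCocycles.pullback (ContinuousMonoidHom.id _) (resIdHom (twistRepHomOn W A' u hu hV)) φ) :=
  cohomologyMap_oneCocycleClass _ φ

/-- `u_*` is `ℤ_p`-linear (it is the underlying map of a morphism of topological `ℤ_p`-modules). [cite: SerreGaloisCohomology1997, I §2.4] -/
theorem twistH1On_smul (c : ℤ_[p]) (y : H1 (tateRep A' p) V) :
    twistH1On W A' u hu hV (c • y) = c • twistH1On W A' u hu hV y :=
  map_smul (twistH1On W A' u hu hV).hom c y

/-- `u_*` is additive. [cite: SerreGaloisCohomology1997, I §2.4] -/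
theorem twistH1On_add (y y' : H1 (tateRep A' p) V) :
    twistH1On W A' u hu hV (y + y') = twistH1On W A' u hu hV y + twistH1On W A' u hu hV y' :=
  map_add (twistH1On W A' u hu hV).hom y y'

/-- **`u_*` preserves the integral classes** `integralH1 · p V` (a coboundary `g·w − w` on an inertia subgroup maps to the
coboundary of `u w`, `u` being `V`-equivariant). [cite: Kato2004Asterisque, §8.2 and Lemma 8.5 (pp. 180–184)] -/
theorem twistH1On_mem_integralH1 {c : H1 (tateRep A' p) V} (hc : c ∈ integralH1 (tateRep A' p) p V) :
    twistH1On W A' u hu hV c ∈ integralH1 (tateRep W p) p V := by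
  rw [mem_integralH1_iff] at hc ⊢
  intro v hv 𝔓 h𝔓
  obtain ⟨φ, rfl⟩ := oneCocycleClass_surjective _ c
  have h0 := hc v hv 𝔓 h𝔓
  rw [resLe_oneCocycleClass, oneCocycleClass_eq_zero_iff] at h0
  obtain ⟨w, hw⟩ := h0
  rw [twistH1On_oneCocycleClass, resLe_oneCocycleClass, oneCocycleClass_eq_zero_iff]
  refine ⟨u w, fun g ↦ ?_⟩
  have key : φ.1 (subgroupInclusion inf_le_left g) = (tateRep A' p).toTopRep.ρ (g : absoluteGaloisGroup ℚ) w - w := hw g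
  rw [contOneCocycles.pullback_apply, TopRep.hom_ofHom]
  change u (φ.1 (subgroupInclusion inf_le_left g)) = (tateRep W p).toTopRep.ρ (g : absoluteGaloisGroup ℚ) (u w) - u w
  rw [key, map_sub, tateRep_ρ_apply', tateRep_ρ_apply', hV _ g.2.1]

/-- **`u_*` commutes with corestriction**: for `V′ ≤ V` open with `u` equivariant on `V` (hence on `V′`),
`u_* (cor_{V′/V} c) = cor_{V′/V} (u_* c)` (transport of the corestriction along the pair `(id, u)`,
`map_coresLe_eq_coresLe_map`). [cite: NeukirchSchmidtWingberg2008, I §5 Prop. 1.5.4] -/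
theorem twistH1On_coresLe {V' : Subgroup (absoluteGaloisGroup ℚ)} (h : V' ≤ V) (hV'o : IsOpen (V' : Set (absoluteGaloisGroup ℚ)))
    [Fintype (V ⧸ V'.subgroupOf V)] (c : H1 (tateRep A' p) V') :
    twistH1On W A' u hu hV (coresLe (tateRep A' p).toTopRep h hV'o c) =
      coresLe (tateRep W p).toTopRep h hV'o (twistH1On W A' u hu (fun σ hσ x ↦ hV σ (h hσ) x) c) :=
  map_coresLe_eq_coresLe_map (tateRep A' p).toTopRep (tateRep W p).toTopRep h hV'o h hV'o
    (ContinuousMonoidHom.id _) (ContinuousMonoidHom.id _) (fun x ↦ by simp)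
    (fun x ↦ by rw [ContinuousMonoidHom.coe_id, id_eq])
    (fun g ↦ ⟨g, by rw [ContinuousMonoidHom.coe_id, id_eq, inv_mul_cancel]; exact Subgroup.one_mem _⟩)
    (resIdHom (twistRepHomOn W A' u hu hV)) (resIdHom (twistRepHomOn W A' u hu (fun σ hσ x ↦ hV σ (h hσ) x)))
    (fun m ↦ by rw [resIdHom_hom_apply, resIdHom_hom_apply, twistRepHomOn_hom_apply, twistRepHomOn_hom_apply]) c

/-- **`u_*` commutes with the action of every `g ∈ Gal(ℚ̄/ℚ)` on which `u` is equivariant** (`V` normal, so that `g` acts on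
`H¹(V, ·)` by conjugation): `u_* (g · c) = g · u_* c`. [cite: NeukirchSchmidtWingberg2008, I §5 Prop. 1.5.4] -/
theorem twistH1On_conjMap [V.Normal] {g : absoluteGaloisGroup ℚ} (hg : ∀ x : A'.tateModule p, u (g • x) = g • u x)
    (c : H1 (tateRep A' p) V) :
    twistH1On W A' u hu hV (conjMap (tateRep A' p).toTopRep V g 1 c) =
      conjMap (tateRep W p).toTopRep V g 1 (twistH1On W A' u hu hV c) := by
  obtain ⟨φ, rfl⟩ := oneCocycleClass_surjective _ c
  rw [conjMap_oneCocycleClass, twistH1On_oneCocycleClass, twistH1On_oneCocycleClass, conjMap_oneCocycleClass]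
  refine congrArg _ (Subtype.ext (ContinuousMap.ext fun x ↦ ?_))
  rw [pullback_id_resIdHom_apply, conj_pullback_apply, conj_pullback_apply, pullback_id_resIdHom_apply,
    twistRepHomOn_hom_apply, twistRepHomOn_hom_apply]
  exact hg _

/-- **The SIGN**: for `g` with `u (g • x) = −(g • u x)` (the quadratic-twist identification off the stabiliser of `√d`),
`u_* (g · c) = −(g · u_* c)` on `H¹(V, ·)` (`V` normal). [cite: SilvermanAEC2009, X.5 Cor. 5.4] -/
theorem twistH1On_conjMap_of_neg [V.Normal] {g : absoluteGaloisGroup ℚ} (hg : ∀ x : A'.tateModule p, u (g • x) = -(g • u x))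
    (c : H1 (tateRep A' p) V) :
    twistH1On W A' u hu hV (conjMap (tateRep A' p).toTopRep V g 1 c) =
      -conjMap (tateRep W p).toTopRep V g 1 (twistH1On W A' u hu hV c) := by
  obtain ⟨φ, rfl⟩ := oneCocycleClass_surjective _ c
  rw [conjMap_oneCocycleClass, twistH1On_oneCocycleClass, twistH1On_oneCocycleClass, conjMap_oneCocycleClass]
  simp only [← oneCocycleClassₗ_apply, ← map_neg]
  congr 1
  refine Subtype.ext (ContinuousMap.ext fun x ↦ ?_)
  rw [pullback_id_resIdHom_apply, conj_pullback_apply, Submodule.coe_neg, ContinuousMap.neg_apply, conj_pullback_apply,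
    pullback_id_resIdHom_apply, twistRepHomOn_hom_apply, twistRepHomOn_hom_apply]
  exact hg _

end CoefficientChange

end Literature.NumberTheory.EllipticCurves.Kato2004

end
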